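import Literature.Analysis.Calculus.SphericalHarmonicEigen
import Literature.Analysis.Calculus.SphereAngularRigidity
import Mathlib.Analysis.InnerProductSpace.Spectrum
import HarnessLib

/-!
# An `L²(S^{n−1})`-orthonormal eigenbasis of the spherical Laplacian on homogeneous polynomials

Analysis support file (everything proved; definitions with bodies, no named facts) for the
spherical-harmonics route to the sharp Poincaré inequality on spheres (A. Waldron, Invent.
math. 217 (2019), Lemma 3.5): the space `HomL2 n K` of homogeneous polynomials of degree `K` in
`n` variables, made an inner product space by `⟨p, q⟩ = ∮_{S^{n−1}} p q` (positive definite by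
`SphereAngularRigidity` + `SphericalHarmonicEigen`), on which the spherical Laplacian
`q ↦ ρ Δq − K(K+n−2) q` is a symmetric operator (`SphereSpectralShell`); the finite-dimensional
spectral theorem then provides an orthonormal eigenbasis, exported as functions on `ℝⁿ`:

* `HomL2`, `HomL2.sphereCore`, instances, `HomL2.inner_def`;
* `HomL2.sphT`, `HomL2.toFun_sphT`, `HomL2.sphT_isSymmetric`;
* `HomL2.eigenfamily` — **the packaged output**: an `L²(S^{n−1})`-orthonormal family of `C^∞`
  functions (polynomials), eigenfunctions of `T` on the unit sphere with eigenvalues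
  `λ_a ∈ {0} ∪ [n−1, ∞)`, constant on the sphere when `λ_a = 0`, and spanning the restrictions of
  all homogeneous polynomials of degree `K`.

References: (spherical harmonics) [folklore]; A. Waldron, Invent. math. 217 (2019), Lemma 3.5
[Waldron2019].
-/

noncomputable section

open scoped BigOperators RealInnerProductSpace
open MvPolynomial MeasureTheory
open Literature.Analysis.FluidPDE

namespace Literature.Analysis.Calculus

namespace MvPoly

variable {n : ℕ}

/-- The space of homogeneous polynomials of degree `K` in `n` real variables, as a type synonym
(to carry the `L²(S^{n−1})` inner product). [folklore] -/
def HomL2 (n K : ℕ) : Type := ↥(homogeneousSubmodule (Fin n) ℝ K)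

namespace HomL2

variable {K : ℕ}

/-- Transported additive structure. [folklore] -/
instance : AddCommGroup (HomL2 n K) :=
  inferInstanceAs (AddCommGroup ↥(homogeneousSubmodule (Fin n) ℝ K))

/-- Transported module structure. [folklore] -/
instance : Module ℝ (HomL2 n K) :=
  inferInstanceAs (Module ℝ ↥(homogeneousSubmodule (Fin n) ℝ K))

/-- `HomL2 n K` is finite-dimensional. [folklore] -/
instance : Module.Finite ℝ (HomL2 n K) :=
  Module.Finite.iff_fg.mpr (homogeneousSubmodule_fg (Fin n) ℝ K)

/-- The underlying polynomial. [folklore] -/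
def val (q : HomL2 n K) : MvPolynomial (Fin n) ℝ := (show ↥(homogeneousSubmodule (Fin n) ℝ K) from q).1

/-- Build an element from a homogeneous polynomial. [folklore] -/
def mk (p : MvPolynomial (Fin n) ℝ) (hp : p.IsHomogeneous K) : HomL2 n K :=
  (⟨p, (mem_homogeneousSubmodule K p).2 hp⟩ : ↥(homogeneousSubmodule (Fin n) ℝ K))

/-- Unfolding lemma. [folklore] -/
@[simp] theorem val_mk (p : MvPolynomial (Fin n) ℝ) (hp : p.IsHomogeneous K) : (mk p hp).val = p := rfl

/-- Elements are homogeneous of degree `K`. [folklore] -/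
theorem isHomogeneous_val (q : HomL2 n K) : q.val.IsHomogeneous K :=
  (mem_homogeneousSubmodule K _).1 (show ↥(homogeneousSubmodule (Fin n) ℝ K) from q).2

/-- `val` is additive. [folklore] -/
@[simp] theorem val_add (p q : HomL2 n K) : (p + q).val = p.val + q.val := rfl
/-- `val` commutes with scalars. [folklore] -/
@[simp] theorem val_smul (a : ℝ) (p : HomL2 n K) : (a • p).val = a • p.val := rfl
/-- `val 0 = 0`. [folklore] -/
@[simp] theorem val_zero : (0 : HomL2 n K).val = 0 := rfl
/-- `val` of a difference. [folklore] -/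
@[simp] theorem val_sub (p q : HomL2 n K) : (p - q).val = p.val - q.val := rfl

/-- `val` is injective. [folklore] -/
theorem val_injective : Function.Injective (val : HomL2 n K → MvPolynomial (Fin n) ℝ) :=
  fun _ _ h => Subtype.ext h

/-- `val` of a finite sum. [folklore] -/
@[simp] theorem val_sum {κ : Type*} (s : Finset κ) (p : κ → HomL2 n K) :
    (∑ k ∈ s, p k).val = ∑ k ∈ s, (p k).val := by
  classical
  induction s using Finset.induction_on with
  | empty => simp
  | insert a s ha ih => rw [Finset.sum_insert ha, Finset.sum_insert ha, val_add, ih]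

/-- Continuity of the polynomial functions, off the origin. [folklore] -/
theorem continuousOn_toFun (p : MvPolynomial (Fin n) ℝ) :
    ContinuousOn (toFun p) ({0}ᶜ : Set (EuclideanSpace ℝ (Fin n))) :=
  (contDiff_toFun p (m := 0)).continuous.continuousOn

/-- **The `L²(S^{n−1})` inner product core** on `HomL2 n K` (`n ≥ 1`):
`⟨p, q⟩ = ∮_{S^{n−1}} p q`; positive definite because a homogeneous polynomial vanishing on
the sphere is zero. [folklore] -/
@[reducible] def sphereCore [NeZero n] : InnerProductSpace.Core ℝ (HomL2 n K) where
  inner := fun p q => sphereIntegral (volume : Measure (EuclideanSpace ℝ (Fin n)))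
    (fun x => toFun p.val x * toFun q.val x) 1
  conj_inner_symm := fun p q => by simp [mul_comm]
  re_inner_nonneg := fun p => by
    simp only [RCLike.re_to_real]
    exact sphereIntegral_nonneg' (fun x => mul_self_nonneg _) 1
  add_left := fun p q s => by
    simp only [val_add, toFun_add, add_mul]
    exact sphereIntegral_add ((continuousOn_toFun _).mul (continuousOn_toFun _))
      ((continuousOn_toFun _).mul (continuousOn_toFun _)) one_pos
  smul_left := fun p q a => by
    simp only [val_smul, toFun_smul, RCLike.conj_to_real, mul_assoc]
    exact sphereIntegral_mul_left a _ 1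
  definite := fun p hp => by
    have hn : 0 < n := Nat.pos_of_ne_zero (NeZero.ne n)
    have h0 : ∀ x : EuclideanSpace ℝ (Fin n), ‖x‖ = 1 → toFun p.val x = 0 := by
      refine eq_zero_on_sphere_of_sphereIntegral_sq_eq_zero (continuousOn_toFun _) one_pos ?_
      simpa [sq] using hp
    exact val_injective (by
      simpa using eq_zero_of_isHomogeneous_of_forall_sphere hn (isHomogeneous_val p) h0)

/-- The `L²(S^{n−1})` norm. [folklore] -/
instance [NeZero n] : NormedAddCommGroup (HomL2 n K) :=
  @InnerProductSpace.Core.toNormedAddCommGroup ℝ (HomL2 n K) _ _ _ sphereCore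

/-- The `L²(S^{n−1})` inner product space structure. [folklore] -/
instance [NeZero n] : InnerProductSpace ℝ (HomL2 n K) :=
  InnerProductSpace.ofCore _

/-- Finite-dimensionality (for the spectral theorem). [folklore] -/
instance [NeZero n] : FiniteDimensional ℝ (HomL2 n K) := inferInstance

/-- The inner product is the sphere integral of the product. [folklore] -/
theorem inner_def [NeZero n] (p q : HomL2 n K) :
    ⟪p, q⟫ = sphereIntegral (volume : Measure (EuclideanSpace ℝ (Fin n)))
      (fun x => toFun p.val x * toFun q.val x) 1 := rfl

/-- **The spherical Laplacian as a linear operator** on `HomL2 n K`: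
`q ↦ ρ Δq − K(K+n−2) q`. [folklore] -/
def sphT : HomL2 n K →ₗ[ℝ] HomL2 n K where
  toFun q := mk (rho * lap q.val - C ((K : ℝ) * (K + n - 2)) * q.val)
    ((isHomogeneous_rho_mul_lap (isHomogeneous_val q)).sub
      (by simpa using (isHomogeneous_C _ ((K : ℝ) * (K + n - 2))).mul (isHomogeneous_val q)))
  map_add' p q := val_injective (by simp [lap_add]; ring)
  map_smul' a p := val_injective (by
    simp only [val_mk, val_smul, RingHom.id_apply, lap_smul]
    simp only [smul_eq_C_mul]
    ring)

/-- Unfolding lemma for `sphT`. [folklore] -/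
theorem val_sphT (q : HomL2 n K) :
    (sphT q).val = rho * lap q.val - C ((K : ℝ) * (K + n - 2)) * q.val := rfl

/-- `sphT` is the spherical Laplacian on the polynomial functions (everywhere). [folklore] -/
theorem toFun_sphT (q : HomL2 n K) (x : EuclideanSpace ℝ (Fin n)) :
    toFun (sphT q).val x = sphLaplacian (EuclideanSpace.basisFun (Fin n) ℝ) (toFun q.val) x := by
  simp only [val_sphT, toFun_sub, toFun_mul, toFun_C]
  rw [sphLaplacian_toFun_of_isHomogeneous (isHomogeneous_val q), toFun_mul]

/-- **Symmetry of the spherical Laplacian** on `HomL2 n K` for the `L²(S^{n−1})` product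
(`n ≥ 2`). [folklore] -/
theorem sphT_isSymmetric [NeZero n] (hn : 2 ≤ n) : (sphT : HomL2 n K →ₗ[ℝ] HomL2 n K).IsSymmetric := by
  haveI : Nontrivial (EuclideanSpace ℝ (Fin n)) := by
    haveI : Nonempty (Fin n) := ⟨⟨0, by omega⟩⟩
    infer_instance
  intro p q
  rw [inner_def, inner_def]
  simp_rw [toFun_sphT]
  have h2 : ∀ s : HomL2 n K, ContDiffOn ℝ 2 (toFun s.val) ({0}ᶜ : Set (EuclideanSpace ℝ (Fin n))) :=
    fun s => (contDiff_toFun _).contDiffOn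
  have h1 : ∀ s : HomL2 n K, ContDiffOn ℝ 1 (toFun s.val) ({0}ᶜ : Set (EuclideanSpace ℝ (Fin n))) :=
    fun s => (contDiff_toFun _).contDiffOn
  have hp := sphDirichlet_eq_neg_sphereIntegral (EuclideanSpace.basisFun (Fin n) ℝ) (h1 q) (h2 p)
    one_pos
  have hq := sphDirichlet_eq_neg_sphereIntegral (EuclideanSpace.basisFun (Fin n) ℝ) (h1 p) (h2 q)
    one_pos
  rw [sphDirichlet_comm] at hp
  have : sphereIntegral (volume : Measure (EuclideanSpace ℝ (Fin n)))
      (fun x => sphLaplacian (EuclideanSpace.basisFun (Fin n) ℝ) (toFun p.val) x * toFun q.val x) 1 =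
      sphereIntegral (volume : Measure (EuclideanSpace ℝ (Fin n)))
      (fun x => toFun q.val x * sphLaplacian (EuclideanSpace.basisFun (Fin n) ℝ) (toFun p.val) x) 1 :=
    congrArg (fun g => sphereIntegral _ g 1) (funext fun x => mul_comm _ _)
  rw [this]
  linarith

/-! ### The packaged eigenfamily -/

/-- The dimension of `HomL2 n K`. [folklore] -/
def dim (n K : ℕ) : ℕ := Module.finrank ℝ (HomL2 n K)

/-- The orthonormal eigenbasis of `sphT` (spectral theorem). [folklore] -/
def eigenbasis [NeZero n] (hn : 2 ≤ n) : OrthonormalBasis (Fin (dim n K)) ℝ (HomL2 n K) :=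
  (sphT_isSymmetric (K := K) hn).eigenvectorBasis rfl

/-- The eigenvalues `λ_a` of `T` (so that `T e_a = −λ_a e_a`). [folklore] -/
def eigenlam [NeZero n] (hn : 2 ≤ n) (a : Fin (dim n K)) : ℝ :=
  -((sphT_isSymmetric (K := K) hn).eigenvalues rfl a)

/-- The eigenfunctions as functions on `ℝⁿ`. [folklore] -/
def eigenfun [NeZero n] (hn : 2 ≤ n) (a : Fin (dim n K)) : EuclideanSpace ℝ (Fin n) → ℝ :=
  toFun (eigenbasis (K := K) hn a).val

/-- The eigenfunctions are smooth (polynomials). [folklore] -/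
theorem contDiff_eigenfun [NeZero n] (hn : 2 ≤ n) (a : Fin (dim n K)) {m : WithTop ℕ∞} :
    ContDiff ℝ m (eigenfun (K := K) hn a) := contDiff_toFun _

/-- Orthonormality in `L²(S^{n−1})`. [folklore] -/
theorem sphereIntegral_eigenfun_mul [NeZero n] (hn : 2 ≤ n) (a c : Fin (dim n K)) :
    sphereIntegral (volume : Measure (EuclideanSpace ℝ (Fin n)))
      (fun x => eigenfun (K := K) hn a x * eigenfun (K := K) hn c x) 1 = if a = c then 1 else 0 := by
  classical
  rw [eigenfun, eigenfun, ← inner_def]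
  exact (orthonormal_iff_ite.1 (eigenbasis (K := K) hn).orthonormal) a c

/-- The eigen-equation on functions: `T e_a = −λ_a e_a` (everywhere). [folklore] -/
theorem sphLaplacian_eigenfun [NeZero n] (hn : 2 ≤ n) (a : Fin (dim n K)) (x : EuclideanSpace ℝ (Fin n)) :
    sphLaplacian (EuclideanSpace.basisFun (Fin n) ℝ) (eigenfun (K := K) hn a) x =
      -(eigenlam (K := K) hn a) * eigenfun (K := K) hn a x := by
  unfold eigenfun eigenlam eigenbasis
  rw [neg_neg]
  have h := (sphT_isSymmetric (K := K) hn).apply_eigenvectorBasis rfl a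
  have h2 := congrArg (fun q : HomL2 n K => toFun q.val x) h
  simp only [RCLike.ofReal_real_eq_id, id_eq, val_smul, toFun_smul, toFun_sphT] at h2
  exact h2

/-- The eigenvalues are `0` or `≥ n − 1`. [folklore] -/
theorem eigenlam_zero_or_ge [NeZero n] (hn : 2 ≤ n) (a : Fin (dim n K)) :
    eigenlam (K := K) hn a = 0 ∨ (n : ℝ) - 1 ≤ eigenlam (K := K) hn a := by
  have hne : (eigenbasis (K := K) hn a).val ≠ 0 := by
    intro h
    have h1 : eigenbasis (K := K) hn a = 0 := val_injective (by rw [h]; rfl)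
    have h2 := (eigenbasis (K := K) hn).orthonormal.1 a
    rw [h1, norm_zero] at h2
    exact zero_ne_one h2
  exact eigenvalue_zero_or_ge (by omega) (isHomogeneous_val _) hne
    (fun x _ => sphLaplacian_eigenfun hn a x)

/-- Zero modes are constant on the sphere. [folklore] -/
theorem eigenfun_const_of_eigenlam_eq_zero [NeZero n] (hn : 2 ≤ n) (a : Fin (dim n K))
    (h0 : eigenlam (K := K) hn a = 0) {x y : EuclideanSpace ℝ (Fin n)} (hx : ‖x‖ = 1) (hy : ‖y‖ = 1) :
    eigenfun (K := K) hn a x = eigenfun (K := K) hn a y := by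
  haveI : Nontrivial (EuclideanSpace ℝ (Fin n)) := by
    haveI : Nonempty (Fin n) := ⟨⟨0, by omega⟩⟩
    infer_instance
  refine const_on_sphere_of_sphLaplacian_eq_zero (by simpa using hn) (EuclideanSpace.basisFun (Fin n) ℝ)
    ((contDiff_eigenfun hn a).contDiffOn) one_pos (fun z _ => ?_) hx hy
  rw [sphLaplacian_eigenfun hn a z, h0, neg_zero, zero_mul]

/-- **Span**: every homogeneous polynomial of degree `K` is a combination of the eigenfunctions
(as functions). [folklore] -/
theorem exists_eq_sum_eigenfun [NeZero n] (hn : 2 ≤ n) (q : HomL2 n K) :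
    ∃ c : Fin (dim n K) → ℝ, ∀ x, toFun q.val x = ∑ a, c a * eigenfun (K := K) hn a x := by
  refine ⟨fun a => ⟪eigenbasis (K := K) hn a, q⟫, fun x => ?_⟩
  have h := (eigenbasis (K := K) hn).sum_repr' q
  have h' := congrArg (fun s : HomL2 n K => toFun s.val x) h
  simp only [val_sum, val_smul, toFun_sum, toFun_smul] at h'
  rw [← h']
  rfl

end HomL2

end MvPoly

end Literature.Analysis.Calculus
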